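import Literature.NumberTheory.EllipticCurves.HidaFamilyMembersProofs
import Literature.NumberTheory.EllipticCurves.NewformsFiniteProofs
import Literature.NumberTheory.Automorphic.HilbertPartialHasseWeightShiftingProofs
import Mathlib.Algebra.Polynomial.Degree.SmallDegree
import Mathlib.LinearAlgebra.Basis.Flag
import Mathlib.LinearAlgebra.Dimension.OrzechProperty
import HarnessLib

/-!
# A `U_p`-triangular Atkin–Lehner basis of `S_k(Γ₀(N p))` and the count of its diagonal
# characters (proofs only)

Helper file (theorems only: no definition, no named fact; D-0026) of the seat of the named fact
`Literature.NumberTheory.EllipticCurves.hida_exists_congruent_ordinary_newform`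
(`HidaFamilyMembers.lean`), second layer of the classical reduction of that fact to Hida's rank
constancy (Hida, *Elementary Modular Iwasawa Theory* (2022), Lemma 4.1.25 = Cor. 4.2.32): the
structure of `S_k(Γ₀(N p))`, `p ∤ N`, `k ≥ 2`, as a module over the Hecke operators `T_q`
(`q ∤ N p` prime) and `U_p`, read off the Atkin–Lehner basis of the tree
(`linearIndependent_degeneracyMap0_newforms`, `span_range_degeneracyMap0_newforms`: the
`[α_d]_k f`, `f` a newform of level `M`, `M d ∣ N p`) after `p`-STABILISATION of the blocks
`{ι_d f, ι_{pd} f}` (`p ∤ M d`):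

* `exists_triangular_basis` — a basis of `S_k(Γ₀(N p))` indexed by `Fin n` in which every `T_q`
  (`q ∤ N p`) is diagonal and `U_p` is upper triangular, together with its diagonal characters
  `θ i` and the newform `f_i` of level `M_i ∣ N p` labelling the `i`-th vector: `θ i q = a_q(f_i)`
  for `q ≠ p`, and `θ i p ∈ {α_i, β_i}` (the roots of `X² - a_p(f_i) X + p^{k-1}`) if `p ∤ M_i`,
  `θ i p = a_p(f_i)` if `p ∣ M_i` (Diamond–Shurman Prop. 5.6.2: `U_p ι_d = ι_d T_p - p^{k-1} ι_{dp}`,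
  `U_p ι_{pd} = ι_d`; Hida EMI Lemma 3.2.20: `f_α = f - β f(pz)` has `U_p f_α = α f_α`);
* the COUNT of the vectors whose newform satisfies a given condition `C` and whose `U_p`-character
  is a `p`-adic unit (through a fixed `ι : ℚ̄_p ≃ ℂ`):
  `#{i | C(f_i) ∧ |ι⁻¹ θ i p| = 1} = ∑_{M ∣ N} σ₀(N/M) (r(M) + s(M))` with
  `r(M) = #{f ∈ newforms0 M k | C f ∧ |a_p(f)| = 1}` and
  `s(M) = #{f ∈ newforms0 (M p) k | C f ∧ |a_p(f)| = 1}` (exactly one of `α, β` is a unit when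
  `a_p` is, none otherwise: `α β = p^{k-1}`, `α + β = a_p`).

[folklore] (Hida, *Elementary Modular Iwasawa Theory*, Lemma 3.2.20 and §4.2.7; Diamond–Shurman,
Prop. 5.6.2, Thm. 5.8.3; Gouvêa, *Arithmetic of `p`-adic modular forms*, II.3 "`p`-stabilisation".)
-/

noncomputable section

open scoped MatrixGroups ModularForm
open CongruenceSubgroup UpperHalfPlane Module

namespace Literature.NumberTheory.EllipticCurves.ModularForms.HidaRank

/-! ### Norm bookkeeping in `ℚ̄_p` -/

section Norm

variable {p : ℕ} [Fact p.Prime]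

/-- `‖p ^ (k-1)‖ < 1` in `ℚ̄_p` for `k ≥ 2`. [folklore] -/
theorem norm_prime_zpow_lt_one {k : ℤ} (hk : 2 ≤ k) : ‖(p : PadicAlgCl p) ^ (k - 1)‖ < 1 := by
  obtain ⟨m, hm⟩ : ∃ m : ℕ, k - 1 = (m : ℤ) + 1 := ⟨(k - 2).toNat, by omega⟩
  rw [hm, zpow_add_one₀ (Nat.cast_ne_zero.mpr (Fact.out : p.Prime).ne_zero), zpow_natCast,
    norm_mul, norm_pow]
  exact mul_lt_one_of_nonneg_of_lt_one_right (pow_le_one₀ (norm_nonneg _)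
    (Automorphic.PadicAlgCl.norm_natCast_p_lt_one p).le) (norm_nonneg _)
    (Automorphic.PadicAlgCl.norm_natCast_p_lt_one p)

/-- **The roots of `X² - a X + c` are integral when `a` is and `‖c‖ ≤ 1`** (ultrametric: if
`‖u‖ > 1` then `‖u²‖` dominates). [folklore] -/
theorem norm_root_le_one {a c u : PadicAlgCl p} (ha : ‖a‖ ≤ 1) (hc : ‖c‖ ≤ 1)
    (hu : u ^ 2 - a * u + c = 0) : ‖u‖ ≤ 1 := by
  by_contra h
  push Not at h
  have hu0 : 0 < ‖u‖ := one_pos.trans h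
  have h1 : ‖a * u‖ < ‖u ^ 2‖ := by
    rw [norm_mul, norm_pow, sq]
    exact mul_lt_mul_of_pos_right (ha.trans_lt h) hu0
  have h2 : ‖c‖ < ‖u ^ 2‖ := by
    rw [norm_pow, sq]
    exact hc.trans_lt (by nlinarith)
  have h3 : ‖u ^ 2 - a * u + c‖ = ‖u ^ 2‖ := by
    have h1' : ‖-(a * u)‖ < ‖u ^ 2‖ := by rwa [norm_neg]
    have h4 : ‖u ^ 2 - a * u‖ = ‖u ^ 2‖ := by
      rw [sub_eq_add_neg, IsUltrametricDist.norm_add_eq_max_of_norm_ne_norm h1'.ne', max_eq_left h1'.le]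
    rw [IsUltrametricDist.norm_add_eq_max_of_norm_ne_norm (by rw [h4]; exact h2.ne'), h4]
    exact max_eq_left h2.le
  rw [hu, norm_zero] at h3
  exact (pow_pos hu0 2).ne' (by rw [← norm_pow]; exact h3.symm)

/-- **Exactly one of the two roots is a unit when `a` is, none otherwise**: for `u + v = a`,
`u v = c` with `‖c‖ < 1` and `‖u‖, ‖v‖ ≤ 1`,
`[‖u‖ = 1] + [‖v‖ = 1] = [‖a‖ = 1]`. [folklore] -/
theorem ite_norm_add_ite_norm_eq {a c u v : PadicAlgCl p} (hc : ‖c‖ < 1) (hu : ‖u‖ ≤ 1)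
    (hv : ‖v‖ ≤ 1) (hsum : u + v = a) (hprod : u * v = c) :
    ((if ‖u‖ = 1 then 1 else 0) + (if ‖v‖ = 1 then 1 else 0) : ℕ) = if ‖a‖ = 1 then 1 else 0 := by
  have hnot : ¬ (‖u‖ = 1 ∧ ‖v‖ = 1) := by
    rintro ⟨h1, h2⟩
    have : ‖c‖ = 1 := by rw [← hprod, norm_mul, h1, h2, one_mul]
    exact (lt_irrefl 1) (this ▸ hc)
  by_cases h1 : ‖u‖ = 1
  · have h2 : ¬ ‖v‖ = 1 := fun h2 ↦ hnot ⟨h1, h2⟩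
    have hv' : ‖v‖ < 1 := lt_of_le_of_ne hv h2
    have ha : ‖a‖ = 1 := by
      rw [← hsum, IsUltrametricDist.norm_add_eq_max_of_norm_ne_norm (by rw [h1]; exact hv'.ne'),
        h1]
      exact max_eq_left hv'.le
    simp [h1, h2, ha]
  · have hu' : ‖u‖ < 1 := lt_of_le_of_ne hu h1
    by_cases h2 : ‖v‖ = 1
    · have ha : ‖a‖ = 1 := by
        rw [← hsum, IsUltrametricDist.norm_add_eq_max_of_norm_ne_norm (by rw [h2]; exact hu'.ne),
          h2]
        exact max_eq_right hu'.le
      simp [h1, h2, ha]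
    · have hv' : ‖v‖ < 1 := lt_of_le_of_ne hv h2
      have ha : ¬ ‖a‖ = 1 := by
        intro ha
        have := (PadicAlgCl.isNonarchimedean p u v)
        rw [hsum, ha] at this
        exact (lt_irrefl 1) (this.trans_lt (max_lt hu' hv'))
      simp [h1, h2, ha]

end Norm

/-! ### Quadratic roots -/

/-- `X² - a X + c` has a root in `ℂ`. [folklore] -/
theorem exists_root_quadratic (a c : ℂ) : ∃ u : ℂ, u ^ 2 - a * u + c = 0 := by
  obtain ⟨u, hu⟩ := IsAlgClosed.exists_root
    (Polynomial.C (1 : ℂ) * Polynomial.X ^ 2 + Polynomial.C (-a) * Polynomial.X + Polynomial.C c)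
    (by rw [Polynomial.degree_quadratic one_ne_zero]; decide)
  refine ⟨u, ?_⟩
  have h := hu
  simp only [Polynomial.IsRoot.def, Polynomial.eval_add, Polynomial.eval_mul, Polynomial.eval_C,
    Polynomial.eval_pow, Polynomial.eval_X, one_mul, neg_mul] at h
  linear_combination h

/-! ### Divisor bookkeeping -/

section Divisors

/-- The divisors of `K p`, `p ∤ K` prime: those prime to `p` (the divisors of `K`) and `p` times
those. [folklore] -/
theorem sum_divisors_mul_prime {β : Type*} [AddCommMonoid β] {p K : ℕ} (hp : p.Prime)
    (hK : ¬ p ∣ K) (F : ℕ → β) :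
    ∑ d ∈ (K * p).divisors, F d = ∑ e ∈ K.divisors, F e + ∑ e ∈ K.divisors, F (e * p) := by
  classical
  have hK0 : K ≠ 0 := fun h ↦ hK (h ▸ dvd_zero p)
  have hKp0 : K * p ≠ 0 := mul_ne_zero hK0 hp.ne_zero
  have hcop : Nat.Coprime p K := (Nat.Prime.coprime_iff_not_dvd hp).mpr hK
  -- split according to `p ∣ d`
  rw [← Finset.sum_filter_add_sum_filter_not (K * p).divisors (fun d ↦ ¬ p ∣ d)]
  congr 1
  · congr 1
    ext d
    simp only [Finset.mem_filter, Nat.mem_divisors]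
    constructor
    · rintro ⟨⟨hd, -⟩, hpd⟩
      exact ⟨(Nat.Coprime.dvd_of_dvd_mul_right
        ((Nat.Prime.coprime_iff_not_dvd hp).mpr hpd).symm hd), hK0⟩
    · rintro ⟨hd, -⟩
      exact ⟨⟨hd.mul_right p, hKp0⟩, fun hpd ↦ hK (hpd.trans hd)⟩
  · have hinj : Set.InjOn (fun e ↦ e * p) (K.divisors : Set ℕ) := fun x _ y _ h ↦
      Nat.eq_of_mul_eq_mul_right hp.pos h
    rw [← Finset.sum_image hinj]
    congr 1
    ext d
    simp only [Finset.mem_filter, Nat.mem_divisors, not_not, Finset.mem_image]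
    constructor
    · rintro ⟨⟨hd, -⟩, ⟨e, rfl⟩⟩
      refine ⟨e, ⟨?_, hK0⟩, mul_comm e p⟩
      rw [mul_comm] at hd
      exact Nat.dvd_of_mul_dvd_mul_right hp.pos hd
    · rintro ⟨e, ⟨he, -⟩, rfl⟩
      exact ⟨⟨mul_dvd_mul he dvd_rfl, hKp0⟩, dvd_mul_left p e⟩

/-- `#{d | p ∣ d} = #{d | p ∤ d} = σ₀(K)` among the divisors of `K p`, weighted version: for
`p ∤ K`, `∑_{d ∣ K p} (if p ∣ d then A else B) = σ₀(K) • A + σ₀(K) • B`. [folklore] -/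
theorem sum_divisors_mul_prime_ite {β : Type*} [AddCommMonoid β] {p K : ℕ} (hp : p.Prime)
    (hK : ¬ p ∣ K) (A B : β) :
    ∑ d ∈ (K * p).divisors, (if p ∣ d then A else B) =
      K.divisors.card • B + K.divisors.card • A := by
  classical
  rw [sum_divisors_mul_prime hp hK]
  congr 1
  · rw [Finset.sum_ite_of_false, Finset.sum_const]
    intro e he hpe
    exact hK (hpe.trans (Nat.dvd_of_mem_divisors he))
  · rw [Finset.sum_ite_of_true, Finset.sum_const]
    intro e _
    exact dvd_mul_left p e

end Divisors

/-! ### Counting -/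

/-- `∑_{x ∈ S} [P x] = #{a ∈ S | P a}`. [folklore] -/
theorem sum_ite_eq_ncard {α : Type*} (S : Set α) [Fintype ↥S] (P : α → Prop) [DecidablePred P] :
    ∑ x : ↥S, (if P x then 1 else 0) = {a | a ∈ S ∧ P a}.ncard := by
  rw [← Finset.card_filter, ← Fintype.card_subtype, ← Nat.card_eq_fintype_card,
    Nat.card_congr (Equiv.subtypeSubtypeEquivSubtypeInter (· ∈ S) P), ← Nat.card_coe_set_eq]
  rfl

/-! ### The triangular basis -/

section Basis

variable {p : ℕ} [Fact p.Prime]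

set_option maxHeartbeats 4000000 in
/-- **A `U_p`-triangular Atkin–Lehner basis of `S_k(Γ₀(N p))`** (`p ∤ N` prime, `k ≥ 2`), with its
diagonal characters and their count; see the module docstring.  Output: a basis `b` of
`S_k(Γ₀(N p))` indexed by `Fin n`; characters `θ i : ℕ → ℂ`; for each `i` the newform `nf i` of
level `lvl i ∣ N p` the `i`-th vector comes from; `θ i q = a_q(nf i)` for `q ≠ p`; all `θ i q`
(`q` prime) are `p`-integral through `ι`; `T_q (b i) - θ i q • b i ∈ span (b j, j < i)` for every
prime `q ∤ N p` and for `q = p`; and for every condition `C` on newforms and all functions `r`,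
`s` agreeing on the divisors `M ∣ N` with the numbers of newforms `f` of level `M`, resp. `M p`,
with `C f` and `|ι⁻¹ a_p(f)| = 1`:
`#{i | C (nf i) ∧ |ι⁻¹ θ i p| = 1} = ∑_{M ∣ N} σ₀(N/M) (r M + s M)`.
[cite: DiamondShurman2005, Prop. 5.6.2 and Thm. 5.8.3] [cite: Hida2022EMI, Lemma 3.2.20] -/
theorem exists_triangular_basis (ι : PadicAlgCl p ≃+* ℂ) (N' : ℕ) [NeZero N'] (hpN : ¬ p ∣ N')
    (κ : ℤ) (hκ : 2 ≤ κ) :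
    ∃ (n : ℕ) (b : Module.Basis (Fin n) ℂ (CuspForm (Gamma0 (N' * p)) κ)) (θ : Fin n → ℕ → ℂ)
      (lvl : Fin n → ℕ) (_ : ∀ i, NeZero (lvl i)) (nf : ∀ i, CuspForm (Gamma0 (lvl i)) κ),
      (∀ i, lvl i ∣ N' * p) ∧ (∀ i, IsNewform0 (nf i)) ∧
      (∀ i q, q ≠ p → θ i q = (qExpansion 1 ⇑(nf i)).coeff q) ∧
      (∀ i q, q.Prime → ‖ι.symm (θ i q)‖ ≤ 1) ∧
      (∀ (q : ℕ) (hq : q.Prime), (¬ q ∣ N' * p ∨ q = p) → ∀ i,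
        (haveI : NeZero q := ⟨hq.ne_zero⟩; heckeT (Gamma0 (N' * p)) κ q (b i)) - θ i q • b i ∈
          b.flag i.castSucc) ∧
      (∀ (C : (M : ℕ) → CuspForm (Gamma0 M) κ → Prop) (r s : ℕ → ℕ),
        (∀ (M : ℕ) [NeZero M], M ∣ N' →
          r M = {f : CuspForm (Gamma0 M) κ | IsNewform0 f ∧ C M f ∧
            ‖ι.symm ((qExpansion 1 ⇑f).coeff p)‖ = 1}.ncard) →
        (∀ (M : ℕ) [NeZero M], M ∣ N' →
          s M = {f : CuspForm (Gamma0 (M * p)) κ | IsNewform0 f ∧ C (M * p) f ∧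
            ‖ι.symm ((qExpansion 1 ⇑f).coeff p)‖ = 1}.ncard) →
        {i : Fin n | C (lvl i) (nf i) ∧ ‖ι.symm (θ i p)‖ = 1}.ncard =
          ∑ M ∈ N'.divisors, (N' / M).divisors.card * (r M + s M)) := by
  classical
  have hp : p.Prime := Fact.out
  haveI : NeZero p := ⟨hp.ne_zero⟩
  haveI hfd : FiniteDimensional ℂ (CuspForm (Gamma0 (N' * p)) κ) :=
    finiteDimensional_cuspForm_gamma0 (N' * p) κ
  have hpL : p ∣ N' * p := dvd_mul_left p N'
  have hp2L : ¬ p ^ 2 ∣ N' * p := fun h ↦ hpN (by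
    rw [pow_two] at h
    exact (Nat.dvd_of_mul_dvd_mul_right hp.pos (by simpa [mul_comm] using h)))
  -- ### the Atkin–Lehner index type and basis
  let Y : Type := {y : AtkinLehnerIndex (N' * p) // y.1.2 = 1}
  let J : Type := Σ y : Y, ↥(newforms0 y.1.1.1 κ)
  let I : Type := Σ j : J, {x : AtkinLehnerIndex (N' * p) // x.1.1 = j.1.1.1.1}
  -- explicit finite enumerations of the components (needed for the count)
  let eY : ↥(N' * p).divisors ≃ Y :=
    { toFun := fun m ↦ ⟨⟨(m.1, 1), by simpa using Nat.dvd_of_mem_divisors m.2⟩, rfl⟩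
      invFun := fun y ↦ ⟨y.1.1.1, Nat.mem_divisors.mpr
        ⟨(dvd_mul_right _ _).trans y.1.2, NeZero.ne _⟩⟩
      left_inv := fun m ↦ by simp
      right_inv := fun y ↦ by
        obtain ⟨⟨⟨M, e⟩, hMe⟩, he⟩ := y
        simp only at he
        subst he
        rfl }
  haveI : Fintype Y := Fintype.ofEquiv _ eY
  haveI : ∀ y : Y, Fintype ↥(newforms0 y.1.1.1 κ) := fun y ↦ (finite_newforms0_holds _ κ).fintype
  have hdivY : ∀ y : Y, y.1.1.1 ∣ N' * p := fun y ↦ (dvd_mul_right _ _).trans y.1.2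
  let eF : ∀ j : J, ↥((N' * p / j.1.1.1.1).divisors) ≃
      {x : AtkinLehnerIndex (N' * p) // x.1.1 = j.1.1.1.1} := fun j ↦
    { toFun := fun d ↦ ⟨⟨(j.1.1.1.1, d.1), (Nat.dvd_div_iff_mul_dvd (hdivY j.1)).mp
        (Nat.dvd_of_mem_divisors d.2)⟩, rfl⟩
      invFun := fun x ↦ ⟨x.1.1.2, Nat.mem_divisors.mpr ⟨(Nat.dvd_div_iff_mul_dvd (hdivY j.1)).mpr
        (mul_dvd_of_atkinLehnerIndex_fst_eq x), Nat.div_ne_zero_iff_of_dvd (hdivY j.1) |>.mpr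
          ⟨NeZero.ne _, NeZero.ne _⟩⟩⟩
      left_inv := fun d ↦ by simp
      right_inv := fun x ↦ by
        obtain ⟨⟨⟨M, d⟩, hMd⟩, hM⟩ := x
        simp only at hM
        subst hM
        rfl }
  haveI : ∀ j : J, Fintype {x : AtkinLehnerIndex (N' * p) // x.1.1 = j.1.1.1.1} :=
    fun j ↦ Fintype.ofEquiv _ (eF j)
  let w : I → CuspForm (Gamma0 (N' * p)) κ := fun t ↦
    degeneracyMap0 t.1.1.1.1.1 (N' * p) t.2.1.1.2 κ t.1.2.1
  have hli_w : LinearIndependent ℂ w := linearIndependent_degeneracyMap0_newforms (N' * p) κ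
  have hsp_w : ⊤ ≤ Submodule.span ℂ (Set.range w) := (span_range_degeneracyMap0_newforms (N' * p) κ).ge
  let Bw : Module.Basis I ℂ (CuspForm (Gamma0 (N' * p)) κ) := Module.Basis.mk hli_w hsp_w
  have hcardI : Fintype.card I = Module.finrank ℂ (CuspForm (Gamma0 (N' * p)) κ) :=
    (Module.finrank_eq_card_basis Bw).symm
  -- accessors: level `M t = t.1.1.1.1.1`, newform `f t = t.1.2.1`, `d t = t.2.1.1.2`
  have hnew : ∀ t : I, IsNewform0 t.1.2.1 := fun t ↦ t.1.2.2
  have hMd : ∀ t : I, t.1.1.1.1.1 * t.2.1.1.2 ∣ N' * p := fun t ↦ mul_dvd_of_atkinLehnerIndex_fst_eq t.2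
  have hML : ∀ t : I, t.1.1.1.1.1 ∣ N' * p := fun t ↦ hdivY t.1.1
  -- coprimality bookkeeping: if `p ∤ M` and `p ∤ d` then `M (p d) ∣ N p`; if `p ∣ M` then `p ∤ d`
  have hMpd : ∀ t : I, ¬ p ∣ t.1.1.1.1.1 → ¬ p ∣ t.2.1.1.2 →
      t.1.1.1.1.1 * (p * t.2.1.1.2) ∣ N' * p := by
    intro t hM hd
    have hcop : Nat.Coprime (t.1.1.1.1.1 * t.2.1.1.2) p :=
      ((Nat.Prime.coprime_iff_not_dvd hp).mpr (fun h ↦ (hp.dvd_mul.mp h).elim hM hd)).symm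
    have h1 : t.1.1.1.1.1 * t.2.1.1.2 ∣ N' := hcop.dvd_of_dvd_mul_right (hMd t)
    rw [show t.1.1.1.1.1 * (p * t.2.1.1.2) = p * (t.1.1.1.1.1 * t.2.1.1.2) by ring]
    exact (mul_dvd_mul_left p h1).trans (dvd_of_eq (mul_comm p N'))
  have hMN' : ∀ t : I, ¬ p ∣ t.1.1.1.1.1 → ¬ p ∣ t.2.1.1.2 → t.1.1.1.1.1 * t.2.1.1.2 ∣ N' := by
    intro t hM hd
    have hcop : Nat.Coprime (t.1.1.1.1.1 * t.2.1.1.2) p :=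
      ((Nat.Prime.coprime_iff_not_dvd hp).mpr (fun h ↦ (hp.dvd_mul.mp h).elim hM hd)).symm
    exact hcop.dvd_of_dvd_mul_right (hMd t)
  have hpd_of_pM : ∀ t : I, p ∣ t.1.1.1.1.1 → ¬ p ∣ t.2.1.1.2 := by
    intro t hM hd
    exact hp2L (by rw [pow_two]; exact (mul_dvd_mul hM hd).trans (hMd t))
  -- ### `p`-stabilisation: a root `u j` of `X² - a_p(f) X + p^{k-1}` for each newform
  have hroot : ∀ j : J, ∃ u : ℂ, u ^ 2 - (qExpansion 1 ⇑(j.2.1)).coeff p * u + (p : ℂ) ^ (κ - 1) = 0 :=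
    fun j ↦ exists_root_quadratic _ _
  choose u hu using hroot
  -- the modified family
  let v : I → CuspForm (Gamma0 (N' * p)) κ := fun t ↦
    if hM : p ∣ t.1.1.1.1.1 then iota t.1.1.1.1.1 (N' * p) t.2.1.1.2 κ (hMd t) t.1.2.1
    else if hd : p ∣ t.2.1.1.2 then iota t.1.1.1.1.1 (N' * p) t.2.1.1.2 κ (hMd t) t.1.2.1
    else iota t.1.1.1.1.1 (N' * p) t.2.1.1.2 κ (hMd t) t.1.2.1 -
      ((qExpansion 1 ⇑(t.1.2.1)).coeff p - u t.1) •
        iota t.1.1.1.1.1 (N' * p) (p * t.2.1.1.2) κ (hMpd t hM hd) t.1.2.1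
  have hv1 : ∀ t : I, p ∣ t.1.1.1.1.1 →
      v t = iota t.1.1.1.1.1 (N' * p) t.2.1.1.2 κ (hMd t) t.1.2.1 := fun t hM ↦ by
    simp only [v, dif_pos hM]
  have hv2 : ∀ t : I, ¬ p ∣ t.1.1.1.1.1 → p ∣ t.2.1.1.2 →
      v t = iota t.1.1.1.1.1 (N' * p) t.2.1.1.2 κ (hMd t) t.1.2.1 := fun t hM hd ↦ by
    simp only [v, dif_neg hM, dif_pos hd]
  have hv3 : ∀ (t : I) (hM : ¬ p ∣ t.1.1.1.1.1) (hd : ¬ p ∣ t.2.1.1.2),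
      v t = iota t.1.1.1.1.1 (N' * p) t.2.1.1.2 κ (hMd t) t.1.2.1 -
        ((qExpansion 1 ⇑(t.1.2.1)).coeff p - u t.1) •
          iota t.1.1.1.1.1 (N' * p) (p * t.2.1.1.2) κ (hMpd t hM hd) t.1.2.1 := fun t hM hd ↦ by
    simp only [v, dif_neg hM, dif_neg hd]
  -- the partner index `(M, f, p d)` of `(M, f, d)` when `p ∤ M d`, and `(M, f, d / p)` when `p ∣ d`
  have hpartner : ∀ (t : I) (hM : ¬ p ∣ t.1.1.1.1.1) (hd : ¬ p ∣ t.2.1.1.2),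
      ∃ t' : I, t'.1 = t.1 ∧ t'.2.1.1.2 = p * t.2.1.1.2 ∧
        v t' = iota t.1.1.1.1.1 (N' * p) (p * t.2.1.1.2) κ (hMpd t hM hd) t.1.2.1 := by
    intro t hM hd
    refine ⟨⟨t.1, ⟨⟨(t.1.1.1.1.1, p * t.2.1.1.2), hMpd t hM hd⟩, rfl⟩⟩, rfl, rfl, ?_⟩
    exact hv2 ⟨t.1, ⟨⟨(t.1.1.1.1.1, p * t.2.1.1.2), hMpd t hM hd⟩, rfl⟩⟩ hM (dvd_mul_right p _)
  -- ### `v` spans, hence is a basis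
  have hw_mem : ∀ t : I, w t ∈ Submodule.span ℂ (Set.range v) := by
    intro t
    change degeneracyMap0 _ (N' * p) _ κ _ ∈ _
    rw [degeneracyMap0_eq_smul_iota t.1.1.1.1.1 (N' * p) t.2.1.1.2 κ (hMd t)]
    refine Submodule.smul_mem _ _ ?_
    by_cases hM : p ∣ t.1.1.1.1.1
    · rw [← hv1 t hM]; exact Submodule.subset_span ⟨t, rfl⟩
    · by_cases hd : p ∣ t.2.1.1.2
      · rw [← hv2 t hM hd]; exact Submodule.subset_span ⟨t, rfl⟩
      · obtain ⟨t', -, -, ht'⟩ := hpartner t hM hd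
        have : iota t.1.1.1.1.1 (N' * p) t.2.1.1.2 κ (hMd t) t.1.2.1 =
            v t + ((qExpansion 1 ⇑(t.1.2.1)).coeff p - u t.1) • v t' := by
          rw [hv3 t hM hd, ht', sub_add_cancel]
        rw [this]
        exact Submodule.add_mem _ (Submodule.subset_span ⟨t, rfl⟩)
          (Submodule.smul_mem _ _ (Submodule.subset_span ⟨t', rfl⟩))
  have hsp_v : ⊤ ≤ Submodule.span ℂ (Set.range v) := by
    refine hsp_w.trans (Submodule.span_le.mpr ?_)
    rintro _ ⟨t, rfl⟩
    exact hw_mem t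
  have hli_v : LinearIndependent ℂ v := linearIndependent_of_top_le_span_of_card_eq_finrank hsp_v hcardI
  let Bv : Module.Basis I ℂ (CuspForm (Gamma0 (N' * p)) κ) := Module.Basis.mk hli_v hsp_v
  have hBv : ∀ t, Bv t = v t := fun t ↦ by simp [Bv]
  -- ### ordering: the indices with `p ∤ d` first
  let P : I → Prop := fun t ↦ ¬ p ∣ t.2.1.1.2
  set n₀ : ℕ := Fintype.card {t : I // P t} with hn₀
  set n₁ : ℕ := Fintype.card {t : I // ¬ P t} with hn₁
  let e₀ : Fin n₀ ≃ {t : I // P t} := (Fintype.equivFin _).symm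
  let e₁ : Fin n₁ ≃ {t : I // ¬ P t} := (Fintype.equivFin _).symm
  let e : Fin (n₀ + n₁) ≃ I := finSumFinEquiv.symm.trans ((e₀.sumCongr e₁).trans (Equiv.sumCompl P))
  have he_of_P : ∀ t : I, P t → ((e.symm t : Fin (n₀ + n₁)) : ℕ) < n₀ := by
    intro t ht
    simp only [e, Equiv.symm_trans_apply, Equiv.symm_symm, Equiv.sumCompl_symm_apply_of_pos ht,
      Equiv.sumCongr_symm, Equiv.sumCongr_apply, Sum.map_inl, finSumFinEquiv_apply_left,
      Fin.val_castAdd]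
    exact Fin.is_lt _
  have he_of_not_P : ∀ t : I, ¬ P t → n₀ ≤ ((e.symm t : Fin (n₀ + n₁)) : ℕ) := by
    intro t ht
    simp only [e, Equiv.symm_trans_apply, Equiv.symm_symm, Equiv.sumCompl_symm_apply_of_neg ht,
      Equiv.sumCongr_symm, Equiv.sumCongr_apply, Sum.map_inr, finSumFinEquiv_apply_right,
      Fin.val_natAdd]
    exact Nat.le_add_right _ _
  have he_lt : ∀ t₀ t : I, P t₀ → ¬ P t → e.symm t₀ < e.symm t := fun t₀ t h₀ h ↦
    Fin.lt_def.mpr ((he_of_P t₀ h₀).trans_le (he_of_not_P t h))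
  let b : Module.Basis (Fin (n₀ + n₁)) ℂ (CuspForm (Gamma0 (N' * p)) κ) := Bv.reindex e.symm
  have hb : ∀ i, b i = v (e i) := fun i ↦ by simp [b, Module.Basis.reindex_apply, hBv]
  -- ### the characters
  let θp : I → ℂ := fun t ↦
    if p ∣ t.1.1.1.1.1 then (qExpansion 1 ⇑(t.1.2.1)).coeff p
    else if p ∣ t.2.1.1.2 then (qExpansion 1 ⇑(t.1.2.1)).coeff p - u t.1 else u t.1
  let θ : Fin (n₀ + n₁) → ℕ → ℂ := fun i q ↦
    if q = p then θp (e i) else (qExpansion 1 ⇑((e i).1.2.1)).coeff q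
  -- ### `T_q` on the `ι_d f`
  have hTq : ∀ (q : ℕ) (hq : q.Prime) (hqL : ¬ q ∣ N' * p) (t : I) (d' : ℕ) (_ : NeZero d')
      (h : t.1.1.1.1.1 * d' ∣ N' * p),
      (haveI : NeZero q := ⟨hq.ne_zero⟩;
        heckeT (Gamma0 (N' * p)) κ q (iota t.1.1.1.1.1 (N' * p) d' κ h t.1.2.1)) =
        (qExpansion 1 ⇑(t.1.2.1)).coeff q • iota t.1.1.1.1.1 (N' * p) d' κ h t.1.2.1 := by
    intro q hq hqL t d' _ h
    haveI : NeZero q := ⟨hq.ne_zero⟩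
    rw [heckeT_iota h hq hqL, IsNewform0.heckeT_eq_coeff_smul (hnew t) hq, map_smul]
  have hTq_v : ∀ (q : ℕ) (hq : q.Prime) (hqL : ¬ q ∣ N' * p) (t : I),
      (haveI : NeZero q := ⟨hq.ne_zero⟩; heckeT (Gamma0 (N' * p)) κ q (v t)) =
        (qExpansion 1 ⇑(t.1.2.1)).coeff q • v t := by
    intro q hq hqL t
    haveI : NeZero q := ⟨hq.ne_zero⟩
    by_cases hM : p ∣ t.1.1.1.1.1
    · rw [hv1 t hM, hTq q hq hqL t _ inferInstance]
    · by_cases hd : p ∣ t.2.1.1.2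
      · rw [hv2 t hM hd, hTq q hq hqL t _ inferInstance]
      · rw [hv3 t hM hd, map_sub, map_smul, hTq q hq hqL t _ inferInstance,
          hTq q hq hqL t _ inferInstance, smul_sub, smul_comm]
  -- ### `U_p` on the `v t`
  have hap : ∀ t : I, heckeT (Gamma0 t.1.1.1.1.1) κ p t.1.2.1 =
      (qExpansion 1 ⇑(t.1.2.1)).coeff p • t.1.2.1 := fun t ↦
    IsNewform0.heckeT_eq_coeff_smul (hnew t) hp
  -- (a) `p ∣ M`: `U_p ι_d f = a_p ι_d f`
  have hUp1 : ∀ t : I, p ∣ t.1.1.1.1.1 →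
      heckeT (Gamma0 (N' * p)) κ p (v t) = (qExpansion 1 ⇑(t.1.2.1)).coeff p • v t := by
    intro t hM
    rw [hv1 t hM, heckeT_iota_of_not_dvd (hMd t) hp (hpd_of_pM t hM) ⟨fun _ ↦ hpL, fun _ ↦ hM⟩,
      hap t, map_smul]
  -- (b) `p ∤ M d`: `U_p v t = u v t`
  have hUp3 : ∀ (t : I) (hM : ¬ p ∣ t.1.1.1.1.1) (hd : ¬ p ∣ t.2.1.1.2),
      heckeT (Gamma0 (N' * p)) κ p (v t) = u t.1 • v t := by
    intro t hM hd
    have h2 : t.1.1.1.1.1 * (t.2.1.1.2 * p) ∣ N' * p := by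
      rw [show t.2.1.1.2 * p = p * t.2.1.1.2 from mul_comm _ _]; exact hMpd t hM hd
    have hio : iota t.1.1.1.1.1 (N' * p) (t.2.1.1.2 * p) κ h2 t.1.2.1 =
        iota t.1.1.1.1.1 (N' * p) (p * t.2.1.1.2) κ (hMpd t hM hd) t.1.2.1 :=
      iota_congr (mul_comm _ _) _ _ _
    rw [hv3 t hM hd, map_sub, map_smul,
      heckeT_iota_of_dvd_of_not_dvd (hMd t) h2 hp hpL hM hd, hap t, map_smul, hio,
      heckeT_iota_mul (hMpd t hM hd) (hMd t) hp hpL]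
    have hrel : u t.1 * (qExpansion 1 ⇑(t.1.2.1)).coeff p - u t.1 ^ 2 = (p : ℂ) ^ (κ - 1) := by
      linear_combination (-1 : ℂ) * hu t.1
    rw [← hrel]
    module
  -- (c) `p ∤ M`, `p ∣ d`: `U_p v t = (a_p - u) v t + v t₀`, `t₀ = (M, f, d/p)` with `p ∤ d/p`
  have hUp2 : ∀ (t : I) (hM : ¬ p ∣ t.1.1.1.1.1) (hd : p ∣ t.2.1.1.2), ∃ t₀ : I, P t₀ ∧
      heckeT (Gamma0 (N' * p)) κ p (v t) =
        ((qExpansion 1 ⇑(t.1.2.1)).coeff p - u t.1) • v t + v t₀ := by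
    intro t hM hd
    obtain ⟨e₀, he₀⟩ := hd
    haveI : NeZero e₀ := ⟨fun h ↦ NeZero.ne t.2.1.1.2 (by rw [he₀, h, mul_zero])⟩
    have hMpe : t.1.1.1.1.1 * (p * e₀) ∣ N' * p := he₀ ▸ hMd t
    have hMe : t.1.1.1.1.1 * e₀ ∣ N' := by
      have h' : p * (t.1.1.1.1.1 * e₀) ∣ p * N' := by
        have h'' := hMpe
        rw [show t.1.1.1.1.1 * (p * e₀) = p * (t.1.1.1.1.1 * e₀) by ring] at h''
        exact h''.trans (dvd_of_eq (mul_comm N' p))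
      exact Nat.dvd_of_mul_dvd_mul_left hp.pos h'
    have he₀p : ¬ p ∣ e₀ := fun h ↦ hpN (h.trans ((dvd_mul_left e₀ _).trans hMe))
    have hMeL : t.1.1.1.1.1 * e₀ ∣ N' * p := hMe.mul_right p
    let t₀ : I := ⟨t.1, ⟨⟨(t.1.1.1.1.1, e₀), hMeL⟩, rfl⟩⟩
    have hP₀ : P t₀ := he₀p
    refine ⟨t₀, hP₀, ?_⟩
    have hvt : v t = iota t.1.1.1.1.1 (N' * p) (p * e₀) κ hMpe t.1.2.1 := by
      rw [hv2 t hM ⟨e₀, he₀⟩]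
      exact iota_congr he₀ _ _ _
    have hvt₀ : v t₀ = iota t.1.1.1.1.1 (N' * p) e₀ κ hMeL t.1.2.1 -
        ((qExpansion 1 ⇑(t.1.2.1)).coeff p - u t.1) •
          iota t.1.1.1.1.1 (N' * p) (p * e₀) κ hMpe t.1.2.1 := by
      rw [hv3 t₀ hM he₀p]
    rw [hvt, heckeT_iota_mul hMpe hMeL hp hpL, hvt₀]
    abel
  -- ### packaging
  refine ⟨n₀ + n₁, b, θ, fun i ↦ (e i).1.1.1.1.1, fun i ↦ inferInstance, fun i ↦ (e i).1.2.1,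
    fun i ↦ hML (e i), fun i ↦ hnew (e i), fun i q hq ↦ by simp only [θ, if_neg hq], ?_, ?_, ?_⟩
  · -- ### integrality of the characters
    intro i q hq
    have hint : ∀ (t : I) (m : ℕ), ‖ι.symm ((qExpansion 1 ⇑(t.1.2.1)).coeff m)‖ ≤ 1 :=
      fun t m ↦ Automorphic.PadicAlgCl.norm_le_one_of_isIntegral p ((IsNewform0.isIntegral_coeff_holds (hnew t) m).map
        (ι.symm : ℂ →+* PadicAlgCl p).toIntAlgHom)
    have hpc : ‖ι.symm ((p : ℂ) ^ (κ - 1))‖ ≤ 1 := by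
      rw [map_zpow₀, map_natCast]; exact (norm_prime_zpow_lt_one hκ).le
    have hunorm : ∀ t : I, ‖ι.symm (u t.1)‖ ≤ 1 := by
      intro t
      refine norm_root_le_one (hint t p) hpc ?_
      have := congrArg ι.symm (hu t.1)
      simpa [map_sub, map_add, map_mul, map_pow] using this
    simp only [θ]
    split_ifs with hqp
    · simp only [θp]
      split_ifs with h1 h2
      · exact hint _ _
      · rw [map_sub, sub_eq_add_neg]
        refine (IsUltrametricDist.norm_add_le_max _ _).trans (max_le (hint _ _) ?_)
        rw [norm_neg]; exact hunorm _
      · exact hunorm _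
    · exact hint _ _
  · -- ### triangularity
    intro q hq hq' i
    haveI : NeZero q := ⟨hq.ne_zero⟩
    rcases hq' with hqL | hqp
    · -- `q ∤ N p`: diagonal
      have hqp : q ≠ p := fun h ↦ hqL (h ▸ hpL)
      have : heckeT (Gamma0 (N' * p)) κ q (b i) - θ i q • b i = 0 := by
        rw [hb, hTq_v q hq hqL]
        simp only [θ, if_neg hqp, sub_self]
      rw [this]
      exact Submodule.zero_mem _
    · subst hqp
      set t := e i with ht
      have hθ : θ i q = θp t := by simp only [θ, if_pos rfl, ht]
      rw [hb, ← ht, hθ]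
      by_cases hM : q ∣ t.1.1.1.1.1
      · have : heckeT (Gamma0 (N' * q)) κ q (v t) - θp t • v t = 0 := by
          rw [hUp1 t hM]; simp only [θp, if_pos hM, sub_self]
        rw [this]; exact Submodule.zero_mem _
      · by_cases hd : q ∣ t.2.1.1.2
        · obtain ⟨t₀, hP₀, hUt⟩ := hUp2 t hM hd
          have : heckeT (Gamma0 (N' * q)) κ q (v t) - θp t • v t = v t₀ := by
            rw [hUt]; simp only [θp, if_neg hM, if_pos hd, add_sub_cancel_left]
          rw [this, ← hBv, show Bv t₀ = b (e.symm t₀) by simp [b]]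
          refine b.self_mem_flag (Fin.castSucc_lt_castSucc_iff.mpr ?_)
          have := he_lt t₀ t hP₀ (show ¬ P t from not_not.mpr hd)
          rwa [ht, Equiv.symm_apply_apply] at this
        · have : heckeT (Gamma0 (N' * q)) κ q (v t) - θp t • v t = 0 := by
            rw [hUp3 t hM hd]; simp only [θp, if_neg hM, if_neg hd, sub_self]
          rw [this]; exact Submodule.zero_mem _
  · -- ### the count
    intro C r s hr hs
    -- transport of the newform count along an equality of levels
    have htrans : ∀ (A B : ℕ) (_ : NeZero A) (_ : NeZero B), A = B →
        {f : CuspForm (Gamma0 A) κ | IsNewform0 f ∧ C A f ∧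
            ‖ι.symm ((qExpansion 1 ⇑f).coeff p)‖ = 1}.ncard =
          {f : CuspForm (Gamma0 B) κ | IsNewform0 f ∧ C B f ∧
            ‖ι.symm ((qExpansion 1 ⇑f).coeff p)‖ = 1}.ncard := by
      intro A B _ _ h
      subst h
      rfl
    -- the predicate on the index type
    let Q' : I → Prop := fun t ↦ C t.1.1.1.1.1 t.1.2.1 ∧ ‖ι.symm (θp t)‖ = 1
    have hLHS : {i : Fin (n₀ + n₁) | C (e i).1.1.1.1.1 (e i).1.2.1 ∧ ‖ι.symm (θ i p)‖ = 1}.ncard =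
        ∑ t : I, (if Q' t then 1 else 0) := by
      have h1 : ∀ i, (C (e i).1.1.1.1.1 (e i).1.2.1 ∧ ‖ι.symm (θ i p)‖ = 1) ↔ Q' (e i) := by
        intro i; simp only [θ, if_pos rfl, Q']
      have hc : Nat.card ↥{i : Fin (n₀ + n₁) | C (e i).1.1.1.1.1 (e i).1.2.1 ∧ ‖ι.symm (θ i p)‖ = 1} =
          Nat.card {t : I // Q' t} := Nat.card_congr (e.subtypeEquiv h1)
      rw [← Nat.card_coe_set_eq, hc, Nat.card_eq_fintype_card, Fintype.card_subtype,
        Finset.card_filter]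
    rw [hLHS, Fintype.sum_sigma, Fintype.sum_sigma]
    -- ### the block of one newform `f` of level `M`
    let G' : ℕ → ℕ := fun M ↦
      if p ∣ M then (N' * p / M).divisors.card * s (M / p) else (N' / M).divisors.card * r M
    have hkey : ∀ y : Y, ∑ f : ↥(newforms0 y.1.1.1 κ),
        ∑ x : {x : AtkinLehnerIndex (N' * p) // x.1.1 = (⟨y, f⟩ : J).1.1.1.1},
          (if Q' ⟨⟨y, f⟩, x⟩ then 1 else 0) = G' y.1.1.1 := by
      intro y
      set M : ℕ := y.1.1.1 with hMdef
      have hMLy : M ∣ N' * p := hdivY y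
      -- the inner sum over `d ∣ (N p)/M`
      have hinner : ∀ f : ↥(newforms0 M κ),
          ∑ x : {x : AtkinLehnerIndex (N' * p) // x.1.1 = (⟨y, f⟩ : J).1.1.1.1},
            (if Q' ⟨⟨y, f⟩, x⟩ then 1 else 0) =
            (if p ∣ M then (N' * p / M).divisors.card else (N' / M).divisors.card) *
              (if C M f ∧ ‖ι.symm ((qExpansion 1 ⇑(f : CuspForm (Gamma0 M) κ)).coeff p)‖ = 1
                then 1 else 0) := by
        intro f
        -- as a sum over the divisors of `(N p) / M`
        let gd : ℕ → ℕ := fun d ↦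
          if C M f ∧ ‖ι.symm (if p ∣ M then (qExpansion 1 ⇑(f : CuspForm (Gamma0 M) κ)).coeff p
            else if p ∣ d then (qExpansion 1 ⇑(f : CuspForm (Gamma0 M) κ)).coeff p - u ⟨y, f⟩
            else u ⟨y, f⟩)‖ = 1 then 1 else 0
        have h1 : ∑ x : {x : AtkinLehnerIndex (N' * p) // x.1.1 = (⟨y, f⟩ : J).1.1.1.1},
            (if Q' ⟨⟨y, f⟩, x⟩ then 1 else 0) = ∑ d ∈ (N' * p / M).divisors, gd d := by
          rw [← Finset.sum_coe_sort ((N' * p / M).divisors) gd]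
          exact (Fintype.sum_equiv (eF ⟨y, f⟩) (fun d ↦ gd d)
            (fun x ↦ if Q' ⟨⟨y, f⟩, x⟩ then 1 else 0) fun d ↦ rfl).symm
        rw [h1]
        by_cases hC : C M f
        · by_cases hpM : p ∣ M
          · have : ∀ d, gd d = if ‖ι.symm ((qExpansion 1 ⇑(f : CuspForm (Gamma0 M) κ)).coeff p)‖ = 1
                then 1 else 0 := fun d ↦ by simp only [gd, hC, true_and, if_pos hpM]
            simp only [this, Finset.sum_const, smul_eq_mul, if_pos hpM, hC, true_and]
          · have hMN : M ∣ N' :=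
              ((Nat.Prime.coprime_iff_not_dvd hp).mpr hpM).symm.dvd_of_dvd_mul_right hMLy
            have hK : ¬ p ∣ N' / M := fun h ↦ hpN (h.trans (Nat.div_dvd_of_dvd hMN))
            have hLM : N' * p / M = N' / M * p := (Nat.div_mul_right_comm hMN p).symm
            have : ∀ d, gd d = if p ∣ d
                then (if ‖ι.symm ((qExpansion 1 ⇑(f : CuspForm (Gamma0 M) κ)).coeff p - u ⟨y, f⟩)‖ = 1
                  then 1 else 0)
                else (if ‖ι.symm (u ⟨y, f⟩)‖ = 1 then 1 else 0) := by
              intro d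
              by_cases hpd : p ∣ d
              · simp only [gd, hC, true_and, if_neg hpM, if_pos hpd]
              · simp only [gd, hC, true_and, if_neg hpM, if_neg hpd]
            simp only [this, if_neg hpM, hC, true_and]
            rw [hLM, sum_divisors_mul_prime_ite hp hK, smul_eq_mul, smul_eq_mul, ← mul_add]
            congr 1
            -- exactly one of the roots is a unit iff `a_p` is
            have hint : ‖ι.symm ((qExpansion 1 ⇑(f : CuspForm (Gamma0 M) κ)).coeff p)‖ ≤ 1 :=
              Automorphic.PadicAlgCl.norm_le_one_of_isIntegral p ((IsNewform0.isIntegral_coeff_holds f.2 p).map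
                (ι.symm : ℂ →+* PadicAlgCl p).toIntAlgHom)
            have hpc : ‖ι.symm ((p : ℂ) ^ (κ - 1))‖ < 1 := by
              rw [map_zpow₀, map_natCast]; exact norm_prime_zpow_lt_one hκ
            have hueq := hu ⟨y, f⟩
            have hueq' : ι.symm (u ⟨y, f⟩) ^ 2 -
                ι.symm ((qExpansion 1 ⇑(f : CuspForm (Gamma0 M) κ)).coeff p) * ι.symm (u ⟨y, f⟩) +
                  ι.symm ((p : ℂ) ^ (κ - 1)) = 0 := by
              have := congrArg ι.symm hueq
              simpa only [map_sub, map_add, map_mul, map_pow, map_zero] using this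
            have hun : ‖ι.symm (u ⟨y, f⟩)‖ ≤ 1 := norm_root_le_one hint hpc.le hueq'
            have hvn : ‖ι.symm ((qExpansion 1 ⇑(f : CuspForm (Gamma0 M) κ)).coeff p - u ⟨y, f⟩)‖ ≤ 1 := by
              rw [map_sub, sub_eq_add_neg]
              refine (IsUltrametricDist.norm_add_le_max _ _).trans (max_le hint ?_)
              rw [norm_neg]; exact hun
            rw [map_sub] at hvn ⊢
            exact ite_norm_add_ite_norm_eq hpc hun hvn (by ring)
              (by linear_combination (-1 : PadicAlgCl p) * hueq')
        · have : ∀ d, gd d = 0 := fun d ↦ by simp only [gd, hC, false_and, if_false]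
          simp only [this, Finset.sum_const_zero, hC, false_and, if_false, mul_zero]
      -- summing over the newforms of level `M`
      have h2 : ∑ f : ↥(newforms0 M κ),
          ∑ x : {x : AtkinLehnerIndex (N' * p) // x.1.1 = (⟨y, f⟩ : J).1.1.1.1},
            (if Q' ⟨⟨y, f⟩, x⟩ then 1 else 0) =
          (if p ∣ M then (N' * p / M).divisors.card else (N' / M).divisors.card) *
            {f : CuspForm (Gamma0 M) κ | IsNewform0 f ∧ C M f ∧
              ‖ι.symm ((qExpansion 1 ⇑f).coeff p)‖ = 1}.ncard := by
        simp only [hinner, ← Finset.mul_sum]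
        congr 1
        exact sum_ite_eq_ncard (newforms0 M κ)
          (fun f ↦ C M f ∧ ‖ι.symm ((qExpansion 1 ⇑f).coeff p)‖ = 1)
      rw [h2]
      simp only [G']
      split_ifs with hpM
      · -- `M = M₁ p`, counted by `s M₁`
        congr 1
        obtain ⟨M₁, hM₁⟩ := hpM
        haveI : NeZero M₁ := ⟨fun h ↦ NeZero.ne M (by rw [hM₁, h, mul_zero])⟩
        have hM₁N : M₁ ∣ N' := by
          have : p * M₁ ∣ p * N' := by rw [← hM₁, mul_comm p N']; exact hMLy
          exact Nat.dvd_of_mul_dvd_mul_left hp.pos this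
        rw [show M / p = M₁ by rw [hM₁, Nat.mul_div_cancel_left _ hp.pos], hs M₁ hM₁N]
        exact htrans _ _ _ _ (by rw [hM₁, mul_comm])
      · -- `p ∤ M`, counted by `r M`
        have hMN : M ∣ N' :=
          ((Nat.Prime.coprime_iff_not_dvd hp).mpr hpM).symm.dvd_of_dvd_mul_right hMLy
        rw [hr M hMN]
    simp only [hkey]
    -- ### summing over the levels `M ∣ N p`
    rw [← Fintype.sum_equiv eY (fun m ↦ G' m.1) (fun y ↦ G' y.1.1.1) (fun m ↦ rfl),
      Finset.sum_coe_sort _ G', sum_divisors_mul_prime hp hpN]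
    have h3 : ∀ M ∈ N'.divisors, G' M = (N' / M).divisors.card * r M := by
      intro M hM
      have hpM : ¬ p ∣ M := fun h ↦ hpN (h.trans (Nat.dvd_of_mem_divisors hM))
      simp only [G', if_neg hpM]
    have h4 : ∀ M ∈ N'.divisors, G' (M * p) = (N' / M).divisors.card * s M := by
      intro M hM
      have hM0 : M ≠ 0 := fun h ↦ by simp [h] at hM
      simp only [G', if_pos (dvd_mul_left p M), Nat.mul_div_cancel _ hp.pos,
        Nat.mul_div_mul_right _ _ hp.pos]
    rw [Finset.sum_congr rfl h3, Finset.sum_congr rfl h4, ← Finset.sum_add_distrib]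
    refine Finset.sum_congr rfl fun M _ ↦ ?_
    ring

end Basis

end Literature.NumberTheory.EllipticCurves.ModularForms.HidaRank

end
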